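import Literature.NumberTheory.GaloisRepresentations.HasseArfCyclicBasic
import Mathlib.RingTheory.FractionalIdeal.Extended
import HarnessLib

/-!
# Hasse–Arf for cyclic groups, II: traces of powers of a totally ramified prime
(Serre, *Local Fields*, Ch. III §3 Prop. 7 and Ch. V §3 Lemma 4, global form)

Second file of the series proving Serre's Prop. V.11 in the global Dedekind setting (see
`HasseArfCyclicBasic.lean`).  Serre's norm computations (Ch. V §3 Lemma 4, "`Tr(𝔭_L^n) = 𝔭_K^r`
with `r = ⌊(m + n)/l⌋`") rest on Ch. III §3 Prop. 7: *`Tr(𝔞) ⊆ 𝔟` iff `𝔞 ⊆ 𝔟 𝔇⁻¹`*, `𝔇` the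
different.  We prove the two halves of this for Mathlib's `differentIdeal`, in the "AKLB"
setting of Dedekind domains, and specialise to a totally ramified prime `𝔓` of the Galois
extension `S = integralClosure R L` of `R`, where `𝔭 S = 𝔓^{|G|}` and the trace of `b ∈ S` is
`Σ_{g ∈ G} g b`:

* `Literature.NumberTheory.GaloisRepresentations.trace_mem_coeIdeal_of_differentIdeal_mul_le` —
  **`𝔇 · Q ⊆ 𝔞 B ⇒ Tr(Q) ⊆ 𝔞`** (the argument of Mathlib's
  `not_dvd_differentIdeal_of_intTrace_not_mem`, for an arbitrary ideal `𝔞` of `A`);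
* `…differentIdeal_mul_le_of_forall_trace_mem` — the converse **`Tr(Q) ⊆ 𝔞 ⇒ 𝔇 · Q ⊆ 𝔞 B`**
  (`𝔞 ≠ 0`; via `𝔞⁻¹ Q ⊆ 𝔇⁻¹ = dual(1)`);
* `…map_under_eq_pow_card_of_inertia_eq_top` — **`𝔭 S = 𝔓^{|G|}`** at a totally ramified prime (`𝔓` is the only
  prime over `𝔭`, and `e = |G|`);
* `…sum_smul_mem_pow_of_le` — **`b ∈ 𝔓ʲ`, `|G| t ≤ j + v_𝔓(𝔇) ⇒ Σ_g g b ∈ 𝔓^{|G| t}`**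
  (i.e. `Tr(b) ∈ 𝔭ᵗ`), Serre's Lemma V.4 in inequality form;
* `…exists_sum_smul_not_mem_pow` — **exactness**: if `j + v_𝔓(𝔇) < |G| (t+1)` some `b ∈ 𝔓ʲ` has
  `Σ_g g b ∉ 𝔓^{|G|(t+1)}` (`Tr(𝔓ʲ) ⊄ 𝔭^{t+1}`), the non-vanishing "`β_n ≠ 0`" of Serre V §3
  Prop. 5 (iv).

## References

* J.-P. Serre, *Local Fields*, GTM 67, Springer 1979: Ch. III §3 Prop. 7 (`Tr(𝔞) ⊂ 𝔟 ⇔ 𝔞 ⊂ 𝔟𝔇⁻¹`),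
  Ch. V §3 Lemma 4 and Prop. 5 (iv). [SerreLocalFields1979]
-/

noncomputable section

open scoped Pointwise nonZeroDivisors

namespace Literature.NumberTheory.GaloisRepresentations

/-! ### Serre III §3 Prop. 7 for Mathlib's different: `Tr(Q) ⊆ 𝔞 ⇔ 𝔇 Q ⊆ 𝔞 B` -/

section AKLB

variable {A K L B : Type*} [CommRing A] [Field K] [CommRing B] [Field L] [Algebra A K]
  [Algebra B L] [Algebra A B] [Algebra K L] [Algebra A L] [IsScalarTower A K L]
  [IsScalarTower A B L] [IsDedekindDomain A] [IsDedekindDomain B] [IsFractionRing A K]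
  [IsFractionRing B L] [IsIntegralClosure B A L] [FiniteDimensional K L] [Algebra.IsSeparable K L]
  [Module.IsTorsionFree A B]

/-- **`𝔇 · Q ⊆ 𝔞B` implies `Tr_{L/K}(Q) ⊆ 𝔞`** (Serre III §3 Prop. 7, "if" direction, for Mathlib's
`differentIdeal`): for ideals `𝔞 ⊆ A`, `Q ⊆ B` of Dedekind domains in the AKLB setting with
`differentIdeal A B * Q ≤ 𝔞.map (algebraMap A B)` and `x ∈ Q`, the trace of `x` lies in `𝔞`
(as an element of the fractional ideal `𝔞 ⊆ K`).  The proof is the one of Mathlib's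
`not_dvd_differentIdeal_of_intTrace_not_mem` (`Q ⊆ 𝔞B · dual(1)`, and traces of `dual(1)` are
integral), run for an arbitrary `𝔞`.
Ref: Serre, *Local Fields*, Ch. III §3, Prop. 7. [cite: SerreLocalFields1979, Ch. III §3 Prop. 7] -/
theorem trace_mem_coeIdeal_of_differentIdeal_mul_le {𝔞 : Ideal A} {Q : Ideal B}
    (H0 : differentIdeal A B * Q ≤ 𝔞.map (algebraMap A B)) {x : B} (hxQ : x ∈ Q) :
    Algebra.trace K L (algebraMap B L x) ∈ (𝔞 : FractionalIdeal A⁰ K) := by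
  have H := (FractionalIdeal.coeIdeal_le_coeIdeal' B⁰ (P := L) le_rfl).mpr H0
  rw [FractionalIdeal.coeIdeal_mul, coeIdeal_differentIdeal A K] at H
  replace H := mul_le_mul_right H (FractionalIdeal.dual A K 1)
  have hne : (1 : FractionalIdeal B⁰ L) ≠ 0 := one_ne_zero
  rw [mul_inv_cancel_left₀ (FractionalIdeal.dual_ne_zero A K hne)] at H
  refine FractionalIdeal.mul_induction_on (H ⟨_, hxQ, rfl⟩) ?_ ?_
  · rintro x hx _ ⟨y, hy, rfl⟩
    induction hy using Submodule.span_induction generalizing x with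
    | mem y h =>
      obtain ⟨y, hy, rfl⟩ := h
      obtain ⟨z, hz⟩ :=
        (FractionalIdeal.mem_dual (by simp)).mp hx 1 ⟨1, trivial, (algebraMap B L).map_one⟩
      simp only [Algebra.traceForm_apply, mul_one] at hz
      refine ⟨z * y, Ideal.mul_mem_left _ _ hy, ?_⟩
      rw [Algebra.linearMap_apply, Algebra.linearMap_apply, mul_comm x,
        ← IsScalarTower.algebraMap_apply,
        ← Algebra.smul_def, LinearMap.map_smul_of_tower, ← hz,
        Algebra.smul_def, map_mul, mul_comm]
    | zero => simp
    | add y z _ _ hy hz =>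
      simp only [map_add, mul_add]
      exact Submodule.add_mem _ (hy x hx) (hz x hx)
    | smul y z hz IH =>
      simpa [Algebra.smul_def, mul_assoc, -FractionalIdeal.mem_coeIdeal, mul_left_comm x] using
        IH _ (Submodule.smul_mem _ y hx)
  · simp only [map_add]
    exact fun _ _ h₁ h₂ ↦ Submodule.add_mem _ h₁ h₂

/-- **`Tr_{L/K}(Q) ⊆ 𝔞` implies `𝔇 · Q ⊆ 𝔞B`** (Serre III §3 Prop. 7, "only if" direction, for
Mathlib's `differentIdeal`; `𝔞 ≠ 0`).  If every `x ∈ Q` has trace in `𝔞`, then for `y ∈ 𝔞⁻¹ ⊆ K`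
and `x ∈ Q` all `Tr(y x b)`, `b ∈ B`, are in `A`, so `𝔞⁻¹ Q ⊆ dual(1) = 𝔇⁻¹` and `𝔇 Q ⊆ 𝔞 B`.
Ref: Serre, *Local Fields*, Ch. III §3, Prop. 7. [cite: SerreLocalFields1979, Ch. III §3 Prop. 7] -/
theorem differentIdeal_mul_le_of_forall_trace_mem {𝔞 : Ideal A} (h𝔞 : 𝔞 ≠ ⊥) {Q : Ideal B}
    (H : ∀ x ∈ Q, Algebra.trace K L (algebraMap B L x) ∈ (𝔞 : FractionalIdeal A⁰ K)) :
    differentIdeal A B * Q ≤ 𝔞.map (algebraMap A B) := by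
  classical
  haveI : Algebra.IsIntegral A B := IsIntegralClosure.isIntegral_algebra A L
  have h𝔞' : (𝔞 : FractionalIdeal A⁰ K) ≠ 0 := by
    rwa [Ne, FractionalIdeal.coeIdeal_eq_zero]
  -- Step 1: `ext(𝔞⁻¹) · Q ≤ dual(1)`
  have key : FractionalIdeal.extendedHom L B (𝔞 : FractionalIdeal A⁰ K)⁻¹ *
      (Q : FractionalIdeal B⁰ L) ≤ FractionalIdeal.dual A K 1 := by
    rw [FractionalIdeal.mul_le]
    intro u hu v hv
    -- reduce to generators `u = algebraMap K L y`, `y ∈ 𝔞⁻¹`, by span induction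
    have hu' : u ∈ (FractionalIdeal.extendedHom L B (𝔞 : FractionalIdeal A⁰ K)⁻¹ :
        Submodule B L) := hu
    rw [FractionalIdeal.coe_extendedHom_eq_span] at hu'
    obtain ⟨x, hxQ, rfl⟩ := (FractionalIdeal.mem_coeIdeal B⁰).mp hv
    clear hu hv
    have h1 : (1 : FractionalIdeal B⁰ L) ≠ 0 := one_ne_zero
    induction hu' using Submodule.span_induction with
    | mem u h =>
      obtain ⟨y, hy, rfl⟩ := h
      rw [FractionalIdeal.mem_dual h1]
      rintro a ⟨b, -, rfl⟩
      rw [Algebra.traceForm_apply]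
      -- `Tr(y x b) = y Tr(x b)` with `x b ∈ Q`
      have hxb : x * b ∈ Q := Ideal.mul_mem_right _ _ hxQ
      obtain ⟨z, hz, hz'⟩ := H _ hxb
      have hyz : y * algebraMap A K z ∈ (1 : FractionalIdeal A⁰ K) := by
        have hy' : y ∈ ((𝔞 : FractionalIdeal A⁰ K)⁻¹ : FractionalIdeal A⁰ K) := hy
        rw [FractionalIdeal.mem_inv_iff h𝔞'] at hy'
        exact hy' _ ((FractionalIdeal.mem_coeIdeal A⁰).mpr ⟨z, hz, rfl⟩)
      obtain ⟨w, hw⟩ := (FractionalIdeal.mem_one_iff A⁰).mp hyz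
      refine ⟨w, ?_⟩
      have : algebraMap K L y * algebraMap B L x * Algebra.linearMap B L b =
          y • algebraMap B L (x * b) := by
        rw [Algebra.linearMap_apply, map_mul, Algebra.smul_def, mul_assoc]
      rw [this, LinearMap.map_smul_of_tower, smul_eq_mul, hw, ← hz']
      rfl
    | zero => rw [zero_mul]; exact FractionalIdeal.zero_mem _
    | add u u' _ _ hu hu' =>
      rw [add_mul]
      exact (FractionalIdeal.mem_coe).mp
        (Submodule.add_mem _ ((FractionalIdeal.mem_coe).mpr hu) ((FractionalIdeal.mem_coe).mpr hu'))
    | smul c u _ hu =>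
      rw [smul_mul_assoc]
      exact (FractionalIdeal.mem_coe).mp (Submodule.smul_mem _ c ((FractionalIdeal.mem_coe).mpr hu))
  -- Step 2: multiply by `𝔇 = dual(1)⁻¹` and `ext(𝔞)`
  have hd : FractionalIdeal.dual A K (1 : FractionalIdeal B⁰ L) ≠ 0 :=
    FractionalIdeal.dual_ne_zero A K one_ne_zero
  have hext : FractionalIdeal.extendedHom L B (𝔞 : FractionalIdeal A⁰ K) ≠ 0 := by
    rwa [Ne, FractionalIdeal.extendedHom_eq_zero_iff]
  have hX : FractionalIdeal.extendedHom L B (𝔞 : FractionalIdeal A⁰ K)⁻¹ =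
      (FractionalIdeal.extendedHom L B (𝔞 : FractionalIdeal A⁰ K))⁻¹ := map_inv₀ _ _
  rw [hX] at key
  have H2 : ((differentIdeal A B * Q : Ideal B) : FractionalIdeal B⁰ L) ≤
      ((𝔞.map (algebraMap A B) : Ideal B) : FractionalIdeal B⁰ L) := by
    rw [FractionalIdeal.coeIdeal_mul, coeIdeal_differentIdeal A K,
      ← FractionalIdeal.extendedHom_coeIdeal_eq_map (K := K) L B 𝔞]
    calc (FractionalIdeal.dual A K 1)⁻¹ * (Q : FractionalIdeal B⁰ L)
        = (FractionalIdeal.extendedHom L B (𝔞 : FractionalIdeal A⁰ K) *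
            (FractionalIdeal.extendedHom L B (𝔞 : FractionalIdeal A⁰ K))⁻¹) *
            ((FractionalIdeal.dual A K 1)⁻¹ * (Q : FractionalIdeal B⁰ L)) := by
          rw [mul_inv_cancel₀ hext, one_mul]
      _ = FractionalIdeal.extendedHom L B (𝔞 : FractionalIdeal A⁰ K) *
            (FractionalIdeal.dual A K 1)⁻¹ *
            ((FractionalIdeal.extendedHom L B (𝔞 : FractionalIdeal A⁰ K))⁻¹ *
              (Q : FractionalIdeal B⁰ L)) := by ring
      _ ≤ FractionalIdeal.extendedHom L B (𝔞 : FractionalIdeal A⁰ K) *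
            (FractionalIdeal.dual A K 1)⁻¹ * FractionalIdeal.dual A K 1 := mul_le_mul_right key _
      _ = FractionalIdeal.extendedHom L B (𝔞 : FractionalIdeal A⁰ K) := by
          rw [mul_assoc, inv_mul_cancel₀ hd, mul_one]
  exact (FractionalIdeal.coeIdeal_le_coeIdeal _).mp H2

end AKLB

/-! ### The totally ramified prime: `𝔭 S = 𝔓^{|G|}` and traces of `𝔓`-powers -/

section TotallyRamified

variable (R : Type*) {K L : Type*} [CommRing R] [IsDedekindDomain R] [Field K] [Field L]
  [Algebra R K] [IsFractionRing R K] [Algebra R L] [Algebra K L] [IsScalarTower R K L]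
  [FiniteDimensional K L] [IsGalois K L] (𝔓 : Ideal (integralClosure R L)) [𝔓.IsMaximal]
  [Algebra.IsSeparable (R ⧸ 𝔓.under R) (integralClosure R L ⧸ 𝔓)]

omit [Algebra.IsSeparable (R ⧸ 𝔓.under R) (integralClosure R L ⧸ 𝔓)] in
/-- At a totally ramified prime, **`𝔓` is the only prime of `S` over `𝔭 = 𝔓 ∩ R`**
(transitivity of `G` on the primes over `𝔭`, and `G` fixes `𝔓`).
Ref: Serre, *Local Fields*, Ch. I §7, Prop. 19 and Cor. to Prop. 21. [folklore] -/
theorem eq_of_liesOver_of_inertia_eq_top (htot : 𝔓.inertia (L ≃ₐ[K] L) = ⊤)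
    (M : Ideal (integralClosure R L)) [M.IsMaximal] [M.LiesOver (𝔓.under R)] : M = 𝔓 := by
  haveI := isGaloisGroup_integralClosure R (K := K) (L := L)
  haveI : 𝔓.LiesOver (𝔓.under R) := ⟨rfl⟩
  haveI : (𝔓.under R).IsMaximal := Ideal.IsMaximal.under R 𝔓
  obtain ⟨σ, hσ⟩ := Ideal.exists_smul_eq_of_isGaloisGroup (𝔓.under R) 𝔓 M (L ≃ₐ[K] L)
  rw [← hσ, smul_eq_of_inertia_eq_top htot σ]

/-- **`𝔭 S = 𝔓^{|G|}`** at a totally ramified prime with separable residue extension: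
`𝔭 S = 𝔓ᵉ Q` with `Q` prime to `𝔓` (Dedekind), `Q = S` because every prime factor of `Q` would
lie over `𝔭` and hence equal `𝔓`, and `e = |G|` (`ramificationIdx'_under_eq_card`).
Ref: Serre, *Local Fields*, Ch. I §7, Cor. to Prop. 21 (`𝔭 B = 𝔓ᵉ` in the totally ramified
case). [cite: SerreLocalFields1979, Ch. I §7 Cor. to Prop. 21] -/
theorem map_under_eq_pow_card_of_inertia_eq_top (h𝔓 : 𝔓 ≠ ⊥) (htot : 𝔓.inertia (L ≃ₐ[K] L) = ⊤) :
    (𝔓.under R).map (algebraMap R (integralClosure R L)) = 𝔓 ^ Nat.card (L ≃ₐ[K] L) := by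
  classical
  haveI : IsDedekindDomain (integralClosure R L) := integralClosure.isDedekindDomain R K L
  haveI := faithfulSMul_integralClosure R (K := K) (L := L)
  have hp : 𝔓.under R ≠ ⊥ := Ideal.IsIntegral.comap_ne_bot _ h𝔓
  have hpS : (𝔓.under R).map (algebraMap R (integralClosure R L)) ≠ ⊥ :=
    Ideal.map_ne_bot_of_ne_bot hp
  obtain ⟨Q, hcop, hQ⟩ := Ideal.eq_prime_pow_mul_coprime hpS 𝔓
  rw [← Ideal.IsDedekindDomain.ramificationIdx'_eq_normalizedFactors_count hpS inferInstance h𝔓,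
    ramificationIdx'_under_eq_card R 𝔓 h𝔓 htot] at hQ
  suffices hQtop : Q = ⊤ by rw [hQ, hQtop, Ideal.mul_top]
  by_contra hQtop
  obtain ⟨M, hM, hQM⟩ := Ideal.exists_le_maximal Q hQtop
  haveI := hM
  -- `M ⊇ Q ⊇ 𝔭 S`, so `M` lies over `𝔭`, hence `M = 𝔓 ⊇ Q`, contradicting `𝔓 + Q = S`
  have hle : (𝔓.under R).map (algebraMap R (integralClosure R L)) ≤ M :=
    (hQ.le.trans Ideal.mul_le_left).trans hQM
  haveI : (𝔓.under R).IsMaximal := Ideal.IsMaximal.under R 𝔓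
  haveI : M.LiesOver (𝔓.under R) := by
    refine ⟨((Ideal.IsMaximal.under R 𝔓).eq_of_le (Ideal.IsMaximal.under R M).ne_top ?_)⟩
    exact Ideal.map_le_iff_le_comap.mp hle
  have hM𝔓 : M = 𝔓 := eq_of_liesOver_of_inertia_eq_top R 𝔓 htot M
  rw [hM𝔓] at hQM
  have htop : (⊤ : Ideal (integralClosure R L)) ≤ 𝔓 := hcop ▸ sup_le le_rfl hQM
  exact (Ideal.IsMaximal.ne_top ‹𝔓.IsMaximal›) (top_le_iff.mp htop)

omit [IsDedekindDomain R] [IsFractionRing R K] [𝔓.IsMaximal]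
  [Algebra.IsSeparable (R ⧸ 𝔓.under R) (integralClosure R L ⧸ 𝔓)] in
/-- The trace as a sum over `G`: `Σ_{g ∈ G} g b = Tr_{L/K}(b)` inside `L` (Mathlib's
`trace_eq_sum_automorphisms`).  Ref: Serre, *Local Fields*, Ch. I §7. [folklore] -/
theorem coe_sum_smul_eq_algebraMap_trace (b : integralClosure R L) :
    ((∑ g : L ≃ₐ[K] L, g • b : integralClosure R L) : L) =
      algebraMap K L (Algebra.trace K L (algebraMap (integralClosure R L) L b)) := by
  rw [trace_eq_sum_automorphisms, ← Subalgebra.val_apply, map_sum]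
  refine Finset.sum_congr rfl fun g _ => ?_
  rw [Subalgebra.val_apply, integralClosure.coe_smul]
  rfl

/-- **`Tr(𝔓ʲ) ⊆ 𝔭ᵗ` when `|G| t ≤ j + v_𝔓(𝔇)`** (Serre's Lemma V.4 in inequality form, global, at a
totally ramified prime): for `b ∈ 𝔓ʲ` with `|G| · t ≤ j + v_𝔓(𝔇_{S/R})`, the trace
`Σ_{g ∈ G} g b` lies in `𝔓^{|G| t} = 𝔭ᵗ S`.  (From `𝔇 𝔓ʲ ⊆ 𝔓^{|G|t} = 𝔭ᵗ S` and
`trace_mem_coeIdeal_of_differentIdeal_mul_le`.)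
Ref: Serre, *Local Fields*, Ch. V §3, Lemma 4; Ch. III §3, Prop. 7.
[cite: SerreLocalFields1979, Ch. V §3 Lemma 4] -/
theorem sum_smul_mem_pow_of_le [IsDedekindDomain (integralClosure R L)]
    [Module.IsTorsionFree R (integralClosure R L)] (h𝔓 : 𝔓 ≠ ⊥)
    (htot : 𝔓.inertia (L ≃ₐ[K] L) = ⊤) {j t : ℕ}
    (hjt : ((Nat.card (L ≃ₐ[K] L) * t : ℕ) : ℕ∞) ≤
      j + emultiplicity 𝔓 (differentIdeal R (integralClosure R L)))
    {b : integralClosure R L} (hb : b ∈ 𝔓 ^ j) :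
    ∑ g : L ≃ₐ[K] L, g • b ∈ 𝔓 ^ (Nat.card (L ≃ₐ[K] L) * t) := by
  classical
  haveI : Module.Finite R (integralClosure R L) :=
    IsIntegralClosure.finite R K L (integralClosure R L)
  haveI : IsFractionRing (integralClosure R L) L :=
    integralClosure.isFractionRing_of_finite_extension K L
  haveI : Algebra.IsSeparable K L := IsGalois.to_isSeparable
  have hprime : Prime 𝔓 := Ideal.prime_of_isPrime h𝔓 inferInstance
  -- `𝔇 · 𝔓ʲ ≤ 𝔓^{|G| t} = (𝔭ᵗ) S`
  have hle : differentIdeal R (integralClosure R L) * 𝔓 ^ j ≤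
      ((𝔓.under R) ^ t).map (algebraMap R (integralClosure R L)) := by
    rw [Ideal.map_pow, map_under_eq_pow_card_of_inertia_eq_top R 𝔓 h𝔓 htot, ← pow_mul, ← Ideal.dvd_iff_le,
      pow_dvd_iff_le_emultiplicity, emultiplicity_mul hprime, emultiplicity_pow_self_of_prime hprime,
      add_comm]
    exact hjt
  have hmem := trace_mem_coeIdeal_of_differentIdeal_mul_le (K := K) (L := L) hle hb
  obtain ⟨y, hy, hy'⟩ := (FractionalIdeal.mem_coeIdeal R⁰).mp hmem
  have hsum : ∑ g : L ≃ₐ[K] L, g • b = algebraMap R (integralClosure R L) y := by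
    apply Subtype.val_injective
    rw [coe_sum_smul_eq_algebraMap_trace R (K := K), Subalgebra.coe_algebraMap,
      IsScalarTower.algebraMap_apply R K L, hy']
  rw [hsum, pow_mul, ← map_under_eq_pow_card_of_inertia_eq_top R 𝔓 h𝔓 htot, ← Ideal.map_pow]
  exact Ideal.mem_map_of_mem _ hy

/-- **Exactness: `Tr(𝔓ʲ) ⊄ 𝔭^{t+1}` when `j + v_𝔓(𝔇) < |G| (t+1)`** (global form of "`β_n ≠ 0`" in
Serre V §3 Prop. 5 (iv), via `differentIdeal_mul_le_of_forall_trace_mem`): some `b ∈ 𝔓ʲ` has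
`Σ_g g b ∉ 𝔓^{|G|(t+1)}`.
Ref: Serre, *Local Fields*, Ch. V §3, Lemma 4 and Prop. 5 (iv); Ch. III §3, Prop. 7.
[cite: SerreLocalFields1979, Ch. V §3 Lemma 4 and Prop. 5 (iv)] -/
theorem exists_sum_smul_not_mem_pow [IsDedekindDomain (integralClosure R L)]
    [Module.IsTorsionFree R (integralClosure R L)] (h𝔓 : 𝔓 ≠ ⊥)
    (htot : 𝔓.inertia (L ≃ₐ[K] L) = ⊤) {j t : ℕ}
    (hjt : (j : ℕ∞) + emultiplicity 𝔓 (differentIdeal R (integralClosure R L)) <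
      ((Nat.card (L ≃ₐ[K] L) * (t + 1) : ℕ) : ℕ∞)) :
    ∃ b ∈ 𝔓 ^ j, ∑ g : L ≃ₐ[K] L, g • b ∉ 𝔓 ^ (Nat.card (L ≃ₐ[K] L) * (t + 1)) := by
  classical
  haveI : Module.Finite R (integralClosure R L) :=
    IsIntegralClosure.finite R K L (integralClosure R L)
  haveI : IsFractionRing (integralClosure R L) L :=
    integralClosure.isFractionRing_of_finite_extension K L
  haveI : Algebra.IsSeparable K L := IsGalois.to_isSeparable
  have hprime : Prime 𝔓 := Ideal.prime_of_isPrime h𝔓 inferInstance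
  have hp : 𝔓.under R ≠ ⊥ := Ideal.IsIntegral.comap_ne_bot _ h𝔓
  by_contra hall
  push Not at hall
  -- then every trace of `𝔓ʲ` lies in `𝔭^{t+1}`
  have H : ∀ x ∈ 𝔓 ^ j, Algebra.trace K L (algebraMap (integralClosure R L) L x) ∈
      (((𝔓.under R) ^ (t + 1) : Ideal R) : FractionalIdeal R⁰ K) := by
    intro x hx
    obtain ⟨y, hy⟩ := exists_sum_smul_eq_algebraMap R (K := K) (L := L) x
    have hyS : algebraMap R (integralClosure R L) y ∈ 𝔓 ^ (Nat.card (L ≃ₐ[K] L) * (t + 1)) :=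
      hy ▸ hall x hx
    have hy𝔭 : y ∈ (𝔓.under R) ^ (t + 1) := by
      rw [mem_pow_iff_le_ord, ord_algebraMap_eq_card_mul R 𝔓 h𝔓 htot, Nat.cast_mul] at hyS
      rw [mem_pow_iff_le_ord]
      have hr : (Nat.card (L ≃ₐ[K] L) : ℕ∞) ≠ 0 := by exact_mod_cast Nat.card_pos.ne'
      have hr' : (Nat.card (L ≃ₐ[K] L) : ℕ∞) ≠ ⊤ := ENat.coe_ne_top _
      exact (ENat.mul_le_mul_left_iff hr hr').mp hyS
    refine (FractionalIdeal.mem_coeIdeal R⁰).mpr ⟨y, hy𝔭, ?_⟩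
    apply (algebraMap K L).injective
    rw [← IsScalarTower.algebraMap_apply R K L, ← coe_sum_smul_eq_algebraMap_trace R (K := K), hy,
      Subalgebra.coe_algebraMap]
  have hle := differentIdeal_mul_le_of_forall_trace_mem (K := K) (L := L)
    (pow_ne_zero _ hp) H
  rw [Ideal.map_pow, map_under_eq_pow_card_of_inertia_eq_top R 𝔓 h𝔓 htot, ← pow_mul, ← Ideal.dvd_iff_le,
    pow_dvd_iff_le_emultiplicity, emultiplicity_mul hprime, emultiplicity_pow_self_of_prime hprime]
    at hle
  rw [add_comm] at hjt
  exact absurd (lt_of_le_of_lt hle hjt) (lt_irrefl _)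

end TotallyRamified

end Literature.NumberTheory.GaloisRepresentations

end
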